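import Mathlib
import HarnessLib
import Summits.Ventures.LatticeQCDFlow.Exactness.LazyLayers
import Summits.Ventures.LatticeQCDFlow.Exactness.QuasiStaticPathKL
import Summits.Ventures.LatticeQCDFlow.Exactness.QuasiStaticSecondOrder
import Summits.Ventures.LatticeQCDFlow.Scoring.CalibrationTruths

/-!
# The lag law: an under-relaxed switching protocol dissipates more than the quasi-static floor — exactly, for lazy layers

HONEST FRAMING: exact (Metropolis-corrected) sampling algorithms for lattice gauge theory;
figures of merit are autocorrelation/cost numbers at stated couplings and volumes; no
continuum-physics claim.

Venture `LatticeQCDFlow` (cell pub-lqcd), topic `Exactness`, FANOUT row 8 (s0-cpn-nemc, GEN-5).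
OUR WORK (elementary finite sums), nothing cited as a fact.  Row 8's earlier files pin the
QUASI-STATIC cost `KL_qs` of the stepwise linear protocol `S_c = S₀ + c • D` — the value of the
printed `D̃_KL = ⟨W⟩ − ΔF` when every layer relaxes perfectly (`QuasiStaticPathKL`), equal to
`(⟨D⟩_0 − ⟨D⟩_1)/(2n) ± M/(12n²)` (`QuasiStaticSecondOrder`) — and leave OPEN what an
UNDER-relaxed protocol dissipates ("a statement about the dynamics", `QuasiStaticDissipation`
docstring; "NOT claimed: monotonicity of `D(P_F ‖ P_R)` in the amount of relaxation",
`QuasiStaticPathKL`).  This file settles both for the solvable class of LAZY PERFECT-RELAXATION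
layers `P_k = ε·I + (1 − ε)·Π_{c_{k+1}}` of `Exactness/LazyLayers.lean` (stay with probability `ε`,
else resample exactly from the next Gibbs law; under them EVERY observable has autocorrelation
`ε^t`, `cov_lazyLayer_lawAt`, hence `τ_int = (1 + ε)/(2(1 − ε))`), for ANY grid `c_0, …, c_n` and
any laziness `ε`:

* `lagSeq` — the LAG of the mean switch observable behind its equilibrium value:
  `e_0 = 0`, `e_{j+1} = ε (e_j + δ_j)`, `δ_j = ⟨D⟩_{c_j} − ⟨D⟩_{c_{j+1}}`
  (`evolveLaw_lazy_meanD`: `E_{μ_j}[D] = ⟨D⟩_{c_j} + e_j`); closed form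
  `e_j = Σ_{i<j} ε^{j−i} δ_i` (`lagSeq_eq_sum`), `e ≥ 0` and monotone in `ε` along a monotone grid,
  `(1 − ε) Σ_{j<n} e_j = ε Σ_{j<n} δ_j − e_n` (`sum_lagSeq_eq`);
* `lazyDissipation` := `⟨W⟩ − ΔF` of the protocol with lazy layers (`= D(P_F ‖ P_R)`, the printed
  `D̃_KL`, for `0 ≤ ε < 1`: `kl_path_lazy_eq`) and **`lazyDissipation_eq`** (THE LAG LAW, exact):
  `⟨W⟩ − ΔF = KL_qs + Σ_{j<n} (c_{j+1} − c_j) e_j` — the quasi-static floor PLUS the work done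
  against the lag;
* consequences: `qsDissipation_le_lazyDissipation` (**under-relaxation costs**: `KL_qs ≤ ⟨W⟩ − ΔF`
  along any monotone grid for `ε ≥ 0`; equality at `ε = 0`, `lazyDissipation_zero`),
  `lazyDissipation_mono` (MORE laziness ⇒ MORE dissipation: `D(P_F ‖ P_R)` IS monotone in the
  amount of relaxation within this class), `lazyDissipation_one` (at `ε = 1`, no relaxation, the
  `n`-step protocol costs exactly the ONE-switch amount `(c_n − c_0)⟨D⟩_{c_0} − ΔF`: steps without
  relaxation buy nothing);
* the uniform grid `c_j = j/n` (Bonanno–Nada–Vadacchino's `c(n) = n/n_step`):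
  `lazyDissipation_uniform_eq` (`⟨W⟩ − ΔF = KL_qs + (1/n) Σ_j e_j`), `lazyDissipation_uniform_le`
  (`≤ KL_qs + (ε/(1−ε))·(⟨D⟩_0 − ⟨D⟩_1)/n`), `lazyDissipation_uniform_ge`
  (`≥ KL_qs + (ε/n)·(⟨D⟩_0 − ⟨D⟩_{1−1/n})` — the `ε`-dependence is sharp to first order), and
  **`lazyDissipation_uniform_le_tauInt`**: if `|κ₃,c(D)| ≤ M` on `[0, 1]`,
  `⟨W⟩ − ΔF ≤ 2 τ_int · (⟨D⟩_0 − ⟨D⟩_1)/(2n) + M/(12 n²)` with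
  `τ_int = Scoring.tauInt (fun t => ε^t)` — **the dissipated work is at most `2 τ_int(D)` TIMES THE
  QUASI-STATIC FLOOR**, up to the certified second-order remainder of `QuasiStaticSecondOrder`.

Dictionary / numbers (OURS; HOME/s0-cpn-nemc/RESULTS.md §7(c), §11(b), §12; not proved here): the
flow seat's fitted LAG LAW `W_d ≈ ∫₀¹ Var_c(D)·2τ_D(c) dc/(2n)` (HOME/ADJ-S0-D2-flow.md; cell C08-B
predicted 0.345 vs measured 0.346(18)) is `lazyDissipation_uniform_le_tauInt` read with a
`c`-dependent laziness; the 15 composite-unit cells of the S0-D2 reproduction at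
(N, β, L) = (21, 0.7, 114) sit at `W_d / FLOOR ∈ [1.06, 1.29]`, i.e. in this model class
`2ε/(1 − ε) ∈ [0.06, 0.29]`, a lag-1 autocorrelation `ε ∈ [0.03, 0.13]` of `D` per composite
sweep.  For a general reversible layer the linear-response form of the law replaces `ε^t` by the
normalised autocorrelation function of `D` under the layer; that generalisation is NOT typed here
(only the lazy class is solved exactly), and nothing here is a claim about the heat-bath /
over-relaxation kernels of the production runs.
-/

namespace Summit.Ventures.LatticeQCDFlow.Exactness

open Finset
open Literature.Probability.MarkovChains (IsRowStochastic)
open Summit.Ventures.LatticeQCDFlow.Theory2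

variable {X : Type*} [Fintype X]

/-! ## The lag sequence -/

/-- The LAG of the mean switch observable behind its equilibrium value along the protocol:
`e_0 = 0`, `e_{j+1} = ε (e_j + δ_j)` where `δ_j = ⟨D⟩_{c_j} − ⟨D⟩_{c_{j+1}}` is the equilibrium
drop of the `j`-th step. -/
def lagSeq (ε : ℝ) (δ : ℕ → ℝ) : ℕ → ℝ
  | 0 => 0
  | j + 1 => ε * (lagSeq ε δ j + δ j)

/-- `e_0 = 0`. -/
@[simp] theorem lagSeq_zero (ε : ℝ) (δ : ℕ → ℝ) : lagSeq ε δ 0 = 0 := rfl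

/-- `e_{j+1} = ε (e_j + δ_j)`. -/
theorem lagSeq_succ (ε : ℝ) (δ : ℕ → ℝ) (j : ℕ) :
    lagSeq ε δ (j + 1) = ε * (lagSeq ε δ j + δ j) := rfl

/-- Closed form: `e_j = Σ_{i<j} ε^{j−i} δ_i` (geometric memory of the past drops). -/
theorem lagSeq_eq_sum (ε : ℝ) (δ : ℕ → ℝ) :
    ∀ j, lagSeq ε δ j = ∑ i ∈ range j, ε ^ (j - i) * δ i
  | 0 => by simp
  | j + 1 => by
      rw [lagSeq_succ, lagSeq_eq_sum ε δ j, sum_range_succ, Nat.add_sub_cancel_left, pow_one,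
        mul_add, mul_sum]
      congr 1
      refine sum_congr rfl fun i hi => ?_
      rw [Nat.sub_add_comm (mem_range.mp hi).le, pow_succ]
      ring

/-- Perfect relaxation has no lag: `e ≡ 0` at `ε = 0`. -/
theorem lagSeq_eps_zero (δ : ℕ → ℝ) : ∀ j, lagSeq 0 δ j = 0
  | 0 => rfl
  | j + 1 => by rw [lagSeq_succ, zero_mul]

/-- No relaxation accumulates the whole drop: `e_j = Σ_{i<j} δ_i` at `ε = 1`. -/
theorem lagSeq_eps_one (δ : ℕ → ℝ) : ∀ j, lagSeq 1 δ j = ∑ i ∈ range j, δ i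
  | 0 => by simp
  | j + 1 => by rw [lagSeq_succ, one_mul, lagSeq_eps_one δ j, sum_range_succ]

/-- `e ≥ 0` for `ε ≥ 0` and non-negative drops (a monotone grid). -/
theorem lagSeq_nonneg {ε : ℝ} (hε : 0 ≤ ε) {δ : ℕ → ℝ} (hδ : ∀ i, 0 ≤ δ i) :
    ∀ j, 0 ≤ lagSeq ε δ j
  | 0 => le_rfl
  | j + 1 => mul_nonneg hε (add_nonneg (lagSeq_nonneg hε hδ j) (hδ j))

/-- The lag is monotone in the laziness (non-negative drops). -/
theorem lagSeq_mono {ε ε' : ℝ} (hε : 0 ≤ ε) (hεε' : ε ≤ ε') {δ : ℕ → ℝ} (hδ : ∀ i, 0 ≤ δ i) :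
    ∀ j, lagSeq ε δ j ≤ lagSeq ε' δ j
  | 0 => le_rfl
  | j + 1 => by
      rw [lagSeq_succ, lagSeq_succ]
      have h1 := lagSeq_mono hε hεε' hδ j
      have h2 := lagSeq_nonneg hε hδ j
      exact mul_le_mul hεε' (by linarith) (by linarith [hδ j]) (hε.trans hεε')

/-- One relaxation per step removes the fraction `1 − ε` of the accumulated lag:
`(1 − ε) Σ_{j<n} e_j = ε Σ_{j<n} δ_j − e_n`. -/
theorem sum_lagSeq_eq (ε : ℝ) (δ : ℕ → ℝ) (n : ℕ) :
    (1 - ε) * ∑ j ∈ range n, lagSeq ε δ j = ε * ∑ j ∈ range n, δ j - lagSeq ε δ n := by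
  induction n with
  | zero => simp
  | succ n ih =>
      rw [sum_range_succ, sum_range_succ, mul_add, ih, lagSeq_succ]
      ring

/-- Hence `Σ_{j<n} e_j ≤ (ε/(1−ε)) Σ_{j<n} δ_j` for `0 ≤ ε < 1` and non-negative drops. -/
theorem sum_lagSeq_le {ε : ℝ} (h0 : 0 ≤ ε) (h1 : ε < 1) {δ : ℕ → ℝ} (hδ : ∀ i, 0 ≤ δ i) (n : ℕ) :
    ∑ j ∈ range n, lagSeq ε δ j ≤ ε / (1 - ε) * ∑ j ∈ range n, δ j := by
  have h := sum_lagSeq_eq ε δ n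
  have hn := lagSeq_nonneg h0 hδ n
  rw [div_mul_eq_mul_div, le_div_iff₀ (sub_pos.mpr h1)]
  linarith

/-- First-order lower bound: `ε Σ_{i<n−1} δ_i ≤ Σ_{j<n} e_j` (`e_{j+1} ≥ ε δ_j`). -/
theorem sum_lagSeq_ge {ε : ℝ} (h0 : 0 ≤ ε) {δ : ℕ → ℝ} (hδ : ∀ i, 0 ≤ δ i) (n : ℕ) :
    ε * ∑ i ∈ range (n - 1), δ i ≤ ∑ j ∈ range n, lagSeq ε δ j := by
  cases n with
  | zero => simp
  | succ m =>
      rw [Nat.add_sub_cancel, sum_range_succ', lagSeq_zero, add_zero, mul_sum]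
      refine sum_le_sum fun j _ => ?_
      rw [lagSeq_succ, mul_add]
      have := lagSeq_nonneg h0 hδ j
      nlinarith

/-! ## The lag law for the linear protocol with lazy layers -/

section LagLaw

variable [DecidableEq X]

/-- **The mean of the switch observable lags**: with lazy layers of laziness `ε` along the grid `c`,
the `j`-th marginal of the protocol started in equilibrium at `c 0` has
`E_{μ_j}[D] = ⟨D⟩_{c_j} + e_j`. -/
theorem evolveLaw_lazy_meanD [Nonempty X] (S₀ D : X → ℝ) (c : ℕ → ℝ) (ε : ℝ) :
    ∀ j, ∑ y, evolveLaw (fun k => lazyLayer (gibbsLaw (linAction S₀ D (c (k + 1)))) ε)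
        (gibbsLaw (linAction S₀ D (c 0))) j y * D y
      = meanD S₀ D (c j) + lagSeq ε (fun i => meanD S₀ D (c i) - meanD S₀ D (c (i + 1))) j
  | 0 => by simp [meanD, gibbsMean]
  | j + 1 => by
      have ih := evolveLaw_lazy_meanD S₀ D c ε j
      have hrow : ∀ k x, ∑ y, lazyLayer (gibbsLaw (linAction S₀ D (c (k + 1)))) ε x y = 1 :=
        fun k x => sum_lazyLayer (sum_gibbsLaw _) ε x
      have hmass : ∑ y, evolveLaw (fun k => lazyLayer (gibbsLaw (linAction S₀ D (c (k + 1)))) ε)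
          (gibbsLaw (linAction S₀ D (c 0))) j y = 1 := by
        rw [sum_evolveLaw _ hrow, sum_gibbsLaw]
      rw [evolveLaw_succ]
      simp_rw [stepLaw_lazyLayer _ ε hmass, add_mul, sum_add_distrib, mul_assoc, ← mul_sum, ih]
      simp only [lagSeq_succ, meanD, gibbsMean]
      ring

/-- `⟨W⟩ − ΔF`: the mean dissipated work of the `n`-step linear protocol `S_{c_k} = S₀ + c_k • D`
started in equilibrium at `c 0`, with LAZY perfect-relaxation layers of laziness `ε` after every
switch (`= D(P_F ‖ P_R)`, the printed `D̃_KL`, for `0 ≤ ε < 1`: `kl_path_lazy_eq`). -/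
noncomputable def lazyDissipation (S₀ D : X → ℝ) (c : ℕ → ℝ) (ε : ℝ) (n : ℕ) : ℝ :=
  (∑ ω : Fin (n + 1) → X,
      pathLaw (gibbsLaw (linAction S₀ D (c 0)))
        (fun k : Fin n => lazyLayer (gibbsLaw (linAction S₀ D (c (k + 1)))) ε) ω
      * work (fun k : Fin (n + 1) => linAction S₀ D (c k)) ω)
    - (linFreeEnergy S₀ D (c n) - linFreeEnergy S₀ D (c 0))

/-- The mean work with lazy layers, step by step: `⟨W⟩ = Σ_j (c_{j+1} − c_j)(⟨D⟩_{c_j} + e_j)`. -/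
theorem meanWork_lazy_eq [Nonempty X] (S₀ D : X → ℝ) (c : ℕ → ℝ) (ε : ℝ) (n : ℕ) :
    ∑ ω : Fin (n + 1) → X,
        pathLaw (gibbsLaw (linAction S₀ D (c 0)))
          (fun k : Fin n => lazyLayer (gibbsLaw (linAction S₀ D (c (k + 1)))) ε) ω
        * work (fun k : Fin (n + 1) => linAction S₀ D (c k)) ω
      = ∑ j ∈ range n, (c (j + 1) - c j) *
          (meanD S₀ D (c j) + lagSeq ε (fun i => meanD S₀ D (c i) - meanD S₀ D (c (i + 1))) j) := by
  have hrow : ∀ k x, ∑ y, lazyLayer (gibbsLaw (linAction S₀ D (c (k + 1)))) ε x y = 1 :=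
    fun k x => sum_lazyLayer (sum_gibbsLaw _) ε x
  have h := meanWork_eq_sum_evolveLaw n (gibbsLaw (linAction S₀ D (c 0)))
    (fun k => linAction S₀ D (c k)) (fun k => lazyLayer (gibbsLaw (linAction S₀ D (c (k + 1)))) ε)
    hrow
  beta_reduce at h
  rw [h]
  refine sum_congr rfl fun j _ => ?_
  rw [← evolveLaw_lazy_meanD S₀ D c ε j, mul_sum]
  refine sum_congr rfl fun y _ => ?_
  simp only [linAction]
  ring

/-- **THE LAG LAW (exact).**  Along any grid and for any laziness,
`⟨W⟩ − ΔF = KL_qs + Σ_{j<n} (c_{j+1} − c_j) e_j`: the quasi-static floor PLUS the work done against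
the lag of the switch observable. -/
theorem lazyDissipation_eq [Nonempty X] (S₀ D : X → ℝ) (c : ℕ → ℝ) (ε : ℝ) (n : ℕ) :
    lazyDissipation S₀ D c ε n
      = qsDissipation S₀ D c n
        + ∑ j ∈ range n, (c (j + 1) - c j)
            * lagSeq ε (fun i => meanD S₀ D (c i) - meanD S₀ D (c (i + 1))) j := by
  have tel : ∑ j ∈ range n, (linFreeEnergy S₀ D (c (j + 1)) - linFreeEnergy S₀ D (c j))
      = linFreeEnergy S₀ D (c n) - linFreeEnergy S₀ D (c 0) :=
    Finset.sum_range_sub (fun j => linFreeEnergy S₀ D (c j)) n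
  unfold lazyDissipation qsDissipation
  rw [meanWork_lazy_eq, ← tel, ← sum_sub_distrib, ← sum_add_distrib]
  exact sum_congr rfl fun j _ => by ring

/-- For `0 ≤ ε < 1` the lazy layers are positive and stochastic, and `lazyDissipation` IS the
forward path relative entropy `D(P_F ‖ P_R)` of the protocol (`kl_path_eq_dissipation`), i.e. the
printed `D̃_KL`. -/
theorem kl_path_lazy_eq [Nonempty X] (S₀ D : X → ℝ) (c : ℕ → ℝ) {ε : ℝ} (h0 : 0 ≤ ε) (h1 : ε < 1)
    (n : ℕ) :
    klFin (pathLaw (gibbsLaw (linAction S₀ D (c 0)))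
            (fun k : Fin n => lazyLayer (gibbsLaw (linAction S₀ D (c (k + 1)))) ε))
        (revPathLaw (fun k : Fin (n + 1) => linAction S₀ D (c k))
            (fun k : Fin n => lazyLayer (gibbsLaw (linAction S₀ D (c (k + 1)))) ε))
      = lazyDissipation S₀ D c ε n := by
  have hP : ∀ k : Fin n, IsRowStochastic (lazyLayer (gibbsLaw (linAction S₀ D (c (k + 1)))) ε) :=
    fun k => isRowStochastic_lazyLayer (fun y => (gibbsLaw_pos _ y).le) (sum_gibbsLaw _) h0 h1.le
  have hPpos : ∀ (k : Fin n) (x y : X),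
      0 < lazyLayer (gibbsLaw (linAction S₀ D (c (k + 1)))) ε x y :=
    fun k x y => lazyLayer_pos (gibbsLaw_pos _) h0 h1 x y
  have h := kl_path_eq_dissipation (fun k : Fin (n + 1) => linAction S₀ D (c k))
    (fun k : Fin n => lazyLayer (gibbsLaw (linAction S₀ D (c (k + 1)))) ε) hP hPpos
  simp only [Fin.val_zero, Fin.val_last] at h
  rw [h]
  unfold lazyDissipation linFreeEnergy freeEnergy
  rw [Real.log_div (partitionFn_pos _).ne' (partitionFn_pos _).ne']
  ring

/-- `ε = 0` (perfect relaxation): `⟨W⟩ − ΔF = KL_qs` (row 8's `kl_path_perfect_eq_qsDissipation`,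
recovered). -/
theorem lazyDissipation_zero [Nonempty X] (S₀ D : X → ℝ) (c : ℕ → ℝ) (n : ℕ) :
    lazyDissipation S₀ D c 0 n = qsDissipation S₀ D c n := by
  rw [lazyDissipation_eq]
  simp [lagSeq_eps_zero]

/-- `ε = 1` (NO relaxation): the `n`-step protocol dissipates exactly the ONE-switch amount
`(c_n − c_0)⟨D⟩_{c_0} − (F(c_n) − F(c_0))` — without relaxation, more steps buy nothing. -/
theorem lazyDissipation_one [Nonempty X] (S₀ D : X → ℝ) (c : ℕ → ℝ) (n : ℕ) :
    lazyDissipation S₀ D c 1 n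
      = (c n - c 0) * meanD S₀ D (c 0) - (linFreeEnergy S₀ D (c n) - linFreeEnergy S₀ D (c 0)) := by
  have telc : ∑ j ∈ range n, (c (j + 1) - c j) = c n - c 0 := Finset.sum_range_sub c n
  have telF : ∑ j ∈ range n, (linFreeEnergy S₀ D (c (j + 1)) - linFreeEnergy S₀ D (c j))
      = linFreeEnergy S₀ D (c n) - linFreeEnergy S₀ D (c 0) :=
    Finset.sum_range_sub (fun j => linFreeEnergy S₀ D (c j)) n
  have telD : ∀ j, ∑ i ∈ range j, (meanD S₀ D (c i) - meanD S₀ D (c (i + 1)))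
      = meanD S₀ D (c 0) - meanD S₀ D (c j) :=
    fun j => Finset.sum_range_sub' (fun i => meanD S₀ D (c i)) j
  rw [lazyDissipation_eq, ← telc, ← telF, sum_mul]
  unfold qsDissipation
  simp_rw [lagSeq_eps_one, telD]
  rw [← sum_sub_distrib, ← sum_add_distrib]
  exact sum_congr rfl fun j _ => by ring

/-- **Under-relaxation costs.**  Along a monotone grid and for `ε ≥ 0` the lazy protocol dissipates
AT LEAST the quasi-static floor: `KL_qs ≤ ⟨W⟩ − ΔF`. -/
theorem qsDissipation_le_lazyDissipation [Nonempty X] (S₀ D : X → ℝ) {c : ℕ → ℝ} (hc : Monotone c)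
    {ε : ℝ} (hε : 0 ≤ ε) (n : ℕ) :
    qsDissipation S₀ D c n ≤ lazyDissipation S₀ D c ε n := by
  rw [lazyDissipation_eq]
  have hδ : ∀ i, 0 ≤ meanD S₀ D (c i) - meanD S₀ D (c (i + 1)) :=
    fun i => sub_nonneg.mpr (meanD_antitone S₀ D (hc (Nat.le_succ i)))
  exact le_add_of_nonneg_right (sum_nonneg fun j _ =>
    mul_nonneg (sub_nonneg.mpr (hc (Nat.le_succ j))) (lagSeq_nonneg hε hδ j))

/-- **More laziness, more dissipation** (monotone grid, `0 ≤ ε ≤ ε'`). -/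
theorem lazyDissipation_mono [Nonempty X] (S₀ D : X → ℝ) {c : ℕ → ℝ} (hc : Monotone c)
    {ε ε' : ℝ} (hε : 0 ≤ ε) (hεε' : ε ≤ ε') (n : ℕ) :
    lazyDissipation S₀ D c ε n ≤ lazyDissipation S₀ D c ε' n := by
  rw [lazyDissipation_eq, lazyDissipation_eq]
  have hδ : ∀ i, 0 ≤ meanD S₀ D (c i) - meanD S₀ D (c (i + 1)) :=
    fun i => sub_nonneg.mpr (meanD_antitone S₀ D (hc (Nat.le_succ i)))
  have h : ∑ j ∈ range n, (c (j + 1) - c j)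
        * lagSeq ε (fun i => meanD S₀ D (c i) - meanD S₀ D (c (i + 1))) j
      ≤ ∑ j ∈ range n, (c (j + 1) - c j)
        * lagSeq ε' (fun i => meanD S₀ D (c i) - meanD S₀ D (c (i + 1))) j :=
    sum_le_sum fun j _ =>
      mul_le_mul_of_nonneg_left (lagSeq_mono hε hεε' hδ j) (sub_nonneg.mpr (hc (Nat.le_succ j)))
  linarith

/-! ### The uniform grid `c_j = j/n` -/

/-- The uniform grid is monotone. -/
theorem monotone_div_nat (n : ℕ) : Monotone (fun k : ℕ => (k : ℝ) / n) :=
  fun _ _ hab => div_le_div_of_nonneg_right (Nat.cast_le.mpr hab) (Nat.cast_nonneg n)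

/-- Uniform grid: `⟨W⟩ − ΔF = KL_qs + (1/n) Σ_{j<n} e_j`. -/
theorem lazyDissipation_uniform_eq [Nonempty X] (S₀ D : X → ℝ) (ε : ℝ) {n : ℕ} (hn : n ≠ 0) :
    lazyDissipation S₀ D (fun k => (k : ℝ) / n) ε n
      = qsDissipation S₀ D (fun k => (k : ℝ) / n) n
        + 1 / (n : ℝ) * ∑ j ∈ range n,
            lagSeq ε (fun i => meanD S₀ D ((i : ℝ) / n) - meanD S₀ D (((i + 1 : ℕ) : ℝ) / n)) j := by
  rw [lazyDissipation_eq, mul_sum]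
  congr 1
  refine sum_congr rfl fun j _ => ?_
  rw [succ_div_sub_div hn]

omit [DecidableEq X] in
/-- The total equilibrium drop along the uniform grid telescopes to `⟨D⟩_0 − ⟨D⟩_1`. -/
theorem sum_drop_uniform (S₀ D : X → ℝ) {n : ℕ} (hn : n ≠ 0) :
    ∑ j ∈ range n, (meanD S₀ D ((j : ℝ) / n) - meanD S₀ D (((j + 1 : ℕ) : ℝ) / n))
      = meanD S₀ D 0 - meanD S₀ D 1 := by
  rw [Finset.sum_range_sub' (fun k => meanD S₀ D ((k : ℝ) / n)) n]
  simp [div_self (Nat.cast_ne_zero.mpr hn : (n : ℝ) ≠ 0)]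

/-- **Upper bound.**  `⟨W⟩ − ΔF ≤ KL_qs + (ε/(1−ε))·(⟨D⟩_0 − ⟨D⟩_1)/n` for `0 ≤ ε < 1`. -/
theorem lazyDissipation_uniform_le [Nonempty X] (S₀ D : X → ℝ) {ε : ℝ} (h0 : 0 ≤ ε) (h1 : ε < 1)
    {n : ℕ} (hn : n ≠ 0) :
    lazyDissipation S₀ D (fun k => (k : ℝ) / n) ε n
      ≤ qsDissipation S₀ D (fun k => (k : ℝ) / n) n
        + ε / (1 - ε) * ((meanD S₀ D 0 - meanD S₀ D 1) / n) := by
  have hδ : ∀ i : ℕ, 0 ≤ meanD S₀ D ((i : ℝ) / n) - meanD S₀ D (((i + 1 : ℕ) : ℝ) / n) :=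
    fun i => sub_nonneg.mpr (meanD_antitone S₀ D (div_le_succ_div n i))
  have hL := sum_lagSeq_le h0 h1 hδ n
  rw [sum_drop_uniform S₀ D hn] at hL
  rw [lazyDissipation_uniform_eq S₀ D ε hn]
  have hn' : (0 : ℝ) < 1 / (n : ℝ) := by positivity
  have h := mul_le_mul_of_nonneg_left hL hn'.le
  have e : 1 / (n : ℝ) * (ε / (1 - ε) * (meanD S₀ D 0 - meanD S₀ D 1))
      = ε / (1 - ε) * ((meanD S₀ D 0 - meanD S₀ D 1) / n) := by ring
  linarith

/-- **First-order lower bound.**  `⟨W⟩ − ΔF ≥ KL_qs + (ε/n)·(⟨D⟩_0 − ⟨D⟩_{(n−1)/n})` for `ε ≥ 0`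
(`(n−1)/n = 1 − 1/n`): the `ε`-dependence of the upper bound is sharp to first order. -/
theorem lazyDissipation_uniform_ge [Nonempty X] (S₀ D : X → ℝ) {ε : ℝ} (h0 : 0 ≤ ε) {n : ℕ}
    (hn : n ≠ 0) :
    qsDissipation S₀ D (fun k => (k : ℝ) / n) n
        + ε / n * (meanD S₀ D 0 - meanD S₀ D (((n - 1 : ℕ) : ℝ) / n))
      ≤ lazyDissipation S₀ D (fun k => (k : ℝ) / n) ε n := by
  have hδ : ∀ i : ℕ, 0 ≤ meanD S₀ D ((i : ℝ) / n) - meanD S₀ D (((i + 1 : ℕ) : ℝ) / n) :=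
    fun i => sub_nonneg.mpr (meanD_antitone S₀ D (div_le_succ_div n i))
  have hL := sum_lagSeq_ge h0 hδ n
  rw [Finset.sum_range_sub' (fun k => meanD S₀ D ((k : ℝ) / n)) (n - 1)] at hL
  simp only [Nat.cast_zero, zero_div] at hL
  rw [lazyDissipation_uniform_eq S₀ D ε hn]
  have hn' : (0 : ℝ) < 1 / (n : ℝ) := by positivity
  have h := mul_le_mul_of_nonneg_left hL hn'.le
  have e : 1 / (n : ℝ) * (ε * (meanD S₀ D 0 - meanD S₀ D (((n - 1 : ℕ) : ℝ) / n)))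
      = ε / n * (meanD S₀ D 0 - meanD S₀ D (((n - 1 : ℕ) : ℝ) / n)) := by ring
  linarith

/-- **THE LAG LAW AS A BOUND: dissipation ≤ 2 τ_int × FLOOR + O(n⁻²).**  For `0 ≤ ε < 1` and
`|κ₃,c(D)| ≤ M` along `[0, 1]`, the uniform `n`-step protocol with lazy layers obeys
`⟨W⟩ − ΔF ≤ 2 τ_int · (⟨D⟩_0 − ⟨D⟩_1)/(2n) + M/(12 n²)`, where
`τ_int = Scoring.tauInt (fun t => ε^t) = (1 + ε)/(2(1 − ε))` is the integrated autocorrelation time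
of (every observable, in particular) `D` under the layer (`cov_lazyLayer_lawAt`) and
`(⟨D⟩_0 − ⟨D⟩_1)/(2n)` is the quasi-static floor of `QuasiStaticSecondOrder`. -/
theorem lazyDissipation_uniform_le_tauInt [Nonempty X] (S₀ D : X → ℝ) {ε : ℝ} (h0 : 0 ≤ ε)
    (h1 : ε < 1) {n : ℕ} (hn : n ≠ 0) {M : ℝ} (hM : ∀ c ∈ Set.Icc (0:ℝ) 1, |kappa3D S₀ D c| ≤ M) :
    lazyDissipation S₀ D (fun k => (k : ℝ) / n) ε n
      ≤ 2 * Scoring.tauInt (fun t => ε ^ t) * ((meanD S₀ D 0 - meanD S₀ D 1) / (2 * n))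
        + M / (12 * (n : ℝ) ^ 2) := by
  have hle := lazyDissipation_uniform_le S₀ D h0 h1 hn
  have hqs := (abs_le.mp (abs_qsDissipation_uniform_sub_floor_le S₀ D hn hM)).2
  rw [Scoring.tauInt_geometric (abs_lt.mpr ⟨by linarith, h1⟩)]
  have hn' : (n : ℝ) ≠ 0 := Nat.cast_ne_zero.mpr hn
  have hε : (1 - ε) ≠ 0 := (sub_pos.mpr h1).ne'
  have key : (meanD S₀ D 0 - meanD S₀ D 1) / (2 * n)
        + ε / (1 - ε) * ((meanD S₀ D 0 - meanD S₀ D 1) / n)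
      = 2 * ((1 + ε) / (2 * (1 - ε))) * ((meanD S₀ D 0 - meanD S₀ D 1) / (2 * n)) := by
    field_simp
    ring
  linarith

end LagLaw

end Summit.Ventures.LatticeQCDFlow.Exactness
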